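import Mathlib.Topology.Sheaves.Flasque
import Mathlib.CategoryTheory.Sites.ConstantSheaf
import Mathlib.CategoryTheory.Sites.LocallyBijective
import Mathlib.Topology.Sheaves.LocallySurjective
import Mathlib.Topology.Sheaves.SheafCondition.UniqueGluing
import HarnessLib

/-!
# A constant sheaf on an irreducible space is flasque (Hartshorne II, Ex. 1.16(a))

Topic: `Literature/AlgebraicGeometry/Motives` (support file for `GrothendieckVanishing.lean`: this is
the ingredient II, Ex. 1.16(a) of the proof of Grothendieck's vanishing theorem, Hartshorne III.2.7,
Step 5, where it gives `Hⁱ(X, ℤ) = 0` for `i > 0` on an irreducible space via III.2.5).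

Setting. `X : TopCat.{u}`, `M : AddCommGrpCat.{u}`; the constant sheaf `M_X` is Mathlib's
`(constantSheaf (Opens.grothendieckTopology X) AddCommGrpCat).obj M`, i.e. the sheafification of the
constant presheaf `U ↦ M` (Hartshorne II.1.0.3 defines the constant sheaf directly as the sheaf of
locally constant `M`-valued functions and remarks that it is the sheaf associated to the constant
presheaf, II.1.2/1.0.3). We only use that the sheafification map `toSheafify : (U ↦ M) ⟶ M_X` is locally
injective and locally surjective (Mathlib), so no explicit model of the sheafification is needed.

Main results (all in `namespace Literature`):

* `injective_toSheafify_const_app`: over a nonempty open `U`, `M → M_X(U)` is injective (any space).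
* `surjective_toSheafify_const_app`: over a nonempty open `U` of a preirreducible space,
  `M → M_X(U)` is surjective — the local lifts of a section agree because any two nonempty opens meet.
* `isFlasque_constantSheaf_of_preirreducibleSpace` (**Hartshorne II, Ex. 1.16(a)**): on a
  preirreducible (e.g. irreducible) space every constant sheaf of abelian groups is flasque;
  `isFlasque_constantSheaf'` is the form used by the named fact `Literature.AlgebraicGeometry.Motives.isFlasque_constantSheaf` of
  `GrothendieckVanishing.lean` (irreducible spaces).

## References

* R. Hartshorne, *Algebraic Geometry*, GTM 52, Springer (1977), doi:10.1007/978-1-4757-3849-0,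
  II.1 (constant sheaf, p. 62) and II, Ex. 1.16(a) (p. 67). [Hartshorne1977]
-/

open CategoryTheory TopologicalSpace Opposite Limits

universe u

namespace Literature.AlgebraicGeometry.Motives

variable {X : TopCat.{u}} (M : AddCommGrpCat.{u})

/-- Over a nonempty open set `U` (of any space), the sheafification map `M → M_X(U)` from the
constant presheaf to the constant sheaf is injective: two elements of `M` with the same image agree
on the members of a covering of `U`, and the constant presheaf has identity restriction maps.
[folklore] -/
theorem injective_toSheafify_const_app (U : Opens X) (hU : (U : Set X).Nonempty) :
    Function.Injective
      ((toSheafify (Opens.grothendieckTopology X) ((Functor.const (Opens X)ᵒᵖ).obj M)).app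
        (op U)) := by
  intro a b h
  have hmem := Presheaf.equalizerSieve_mem (Opens.grothendieckTopology X)
    (toSheafify (Opens.grothendieckTopology X) ((Functor.const (Opens X)ᵒᵖ).obj M)) a b h
  obtain ⟨x, hx⟩ := hU
  obtain ⟨V, f, hf, -⟩ := hmem x hx
  have hf' : (𝟙 M : M ⟶ M) a = (𝟙 M : M ⟶ M) b := hf
  simp only [ConcreteCategory.id_apply] at hf'
  exact hf'

/-- Naturality of the sheafification map for the constant presheaf: restricting the image of
`m ∈ M` in `M_X(U)` to `V ⊆ U` gives the image of `m` in `M_X(V)`. [folklore] -/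
theorem map_toSheafify_const_app {U V : Opens X} (i : V ⟶ U) (m : M) :
    (sheafify (Opens.grothendieckTopology X) ((Functor.const (Opens X)ᵒᵖ).obj M)).map i.op
      ((toSheafify (Opens.grothendieckTopology X) ((Functor.const (Opens X)ᵒᵖ).obj M)).app
        (op U) m) =
    (toSheafify (Opens.grothendieckTopology X) ((Functor.const (Opens X)ᵒᵖ).obj M)).app
      (op V) m := by
  have := NatTrans.naturality_apply
    (toSheafify (Opens.grothendieckTopology X) ((Functor.const (Opens X)ᵒᵖ).obj M)) i.op m
  rw [← this]
  rfl

/-- For a sheaf of abelian groups `F` on `X`, every restriction map into `F(∅) = 0` is an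
epimorphism. [folklore] -/
theorem epi_map_of_eq_bot (F : TopCat.Sheaf AddCommGrpCat.{u} X) {U V : Opens X} (i : V ⟶ U)
    (hV : V = ⊥) : Epi (F.obj.map i.op) :=
  (F.isTerminalOfEqEmpty hV).isZero.epi _

variable [PreirreducibleSpace X]

/-- Over a nonempty open set `U` of a preirreducible space, the sheafification map `M → M_X(U)` is
surjective: a section `s` of the constant sheaf is locally the image of elements `m_x ∈ M`
(local surjectivity of sheafification); any two of the opens involved are nonempty and hence meet
(irreducibility), so the `m_x` all coincide by `injective_toSheafify_const_app`, and `s` is the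
image of this common element by the sheaf condition. [folklore] -/
theorem surjective_toSheafify_const_app (U : Opens X) (hU : (U : Set X).Nonempty) :
    Function.Surjective
      ((toSheafify (Opens.grothendieckTopology X) ((Functor.const (Opens X)ᵒᵖ).obj M)).app
        (op U)) := by
  intro s
  have hmem := Presheaf.imageSieve_mem (Opens.grothendieckTopology X)
    (toSheafify (Opens.grothendieckTopology X) ((Functor.const (Opens X)ᵒᵖ).obj M)) s
  choose V f hf hxV using hmem
  obtain ⟨x₀, hx₀⟩ := hU
  refine ⟨(hf x₀ hx₀).choose, ?_⟩
  refine TopCat.Sheaf.eq_of_locally_eq'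
    ((presheafToSheaf (Opens.grothendieckTopology X) AddCommGrpCat.{u}).obj
      ((Functor.const (Opens X)ᵒᵖ).obj M)) (fun x : U => V x.1 x.2) U
    (fun x => f x.1 x.2) ?_ _ _ (fun x => ?_)
  · intro y hy
    exact Opens.mem_iSup.mpr ⟨⟨y, hy⟩, hxV y hy⟩
  · obtain ⟨t, ht⟩ := hf x.1 x.2
    change (sheafify (Opens.grothendieckTopology X) ((Functor.const (Opens X)ᵒᵖ).obj M)).map
        (f x.1 x.2).op _ =
      (sheafify (Opens.grothendieckTopology X) ((Functor.const (Opens X)ᵒᵖ).obj M)).map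
        (f x.1 x.2).op s
    rw [map_toSheafify_const_app, ← ht]
    congr 1
    have hW : ((V x.1 x.2 ⊓ V x₀ hx₀ : Opens X) : Set X).Nonempty :=
      nonempty_preirreducible_inter (V x.1 x.2).2 (V x₀ hx₀).2 ⟨x.1, hxV x.1 x.2⟩ ⟨x₀, hxV x₀ hx₀⟩
    apply injective_toSheafify_const_app M (V x.1 x.2 ⊓ V x₀ hx₀) hW
    rw [← map_toSheafify_const_app M (homOfLE inf_le_right : V x.1 x.2 ⊓ V x₀ hx₀ ⟶ V x₀ hx₀),
      ← map_toSheafify_const_app M (homOfLE inf_le_left : V x.1 x.2 ⊓ V x₀ hx₀ ⟶ V x.1 x.2),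
      (hf x₀ hx₀).choose_spec, ht, ← ConcreteCategory.comp_apply, ← ConcreteCategory.comp_apply,
      ← Functor.map_comp, ← Functor.map_comp]
    rfl

/-- **Hartshorne II, Ex. 1.16(a)** (for the sheafification of the constant presheaf): on a
preirreducible space `X`, the constant sheaf `M_X` is flasque, i.e. all restriction maps
`M_X(U) → M_X(V)` are surjective: for `V = ∅` the target is `0`, and for `V ≠ ∅` both `M_X(U)` and
`M_X(V)` are `M` (`surjective_toSheafify_const_app`). [cite: Hartshorne1977, II Ex. 1.16(a)] -/
theorem isFlasque_sheafify_const :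
    TopCat.Sheaf.IsFlasque ((presheafToSheaf (Opens.grothendieckTopology X) AddCommGrpCat.{u}).obj
      ((Functor.const (Opens X)ᵒᵖ).obj M)) where
  epi {U V} i := by
    obtain ⟨U⟩ := U; obtain ⟨V⟩ := V
    obtain ⟨i⟩ := i
    change Epi ((sheafify (Opens.grothendieckTopology X) ((Functor.const (Opens X)ᵒᵖ).obj M)).map
      i.op)
    rcases eq_bot_or_bot_lt V with hV | hV
    · exact epi_map_of_eq_bot _ i hV
    · have hVne : (V : Set X).Nonempty := by
        simpa [Opens.coe_bot, Set.nonempty_iff_ne_empty] using hV.ne'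
      rw [AddCommGrpCat.epi_iff_surjective]
      intro s
      obtain ⟨m, rfl⟩ := surjective_toSheafify_const_app M V hVne s
      exact ⟨_, map_toSheafify_const_app M i m⟩

/-- **Hartshorne II, Ex. 1.16(a)**: a constant sheaf (of abelian groups, Mathlib's `constantSheaf`)
on a preirreducible topological space is flasque. [cite: Hartshorne1977, II Ex. 1.16(a)] -/
theorem isFlasque_constantSheaf_of_preirreducibleSpace :
    TopCat.Sheaf.IsFlasque
      ((constantSheaf (Opens.grothendieckTopology X) AddCommGrpCat.{u}).obj M) :=
  isFlasque_sheafify_const M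

omit [PreirreducibleSpace X] in
/-- **Hartshorne II, Ex. 1.16(a)**, in the form of the named fact `Literature.AlgebraicGeometry.Motives.isFlasque_constantSheaf` of
`GrothendieckVanishing.lean`: a constant sheaf of abelian groups on an irreducible topological space
is flasque. [cite: Hartshorne1977, II Ex. 1.16(a)] -/
theorem isFlasque_constantSheaf' [IrreducibleSpace X] (A : AddCommGrpCat.{u}) :
    TopCat.Sheaf.IsFlasque
      ((constantSheaf (Opens.grothendieckTopology X) AddCommGrpCat.{u}).obj A) :=
  isFlasque_constantSheaf_of_preirreducibleSpace A

end Literature.AlgebraicGeometry.Motives
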